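import Summits.BirchSwinnertonDyer.Rank1Residual.Additive.CongruentPartnerBudgetSchemaHolds
import Summits.BirchSwinnertonDyer.Rank1Residual.Additive.CongruentPartnerMainConjectureGordBSD
import Literature.NumberTheory.EllipticCurves.IwasawaTowerTorsionProofs
import Literature.NumberTheory.EllipticCurves.AnomalousOfRationalTorsionProofs
import HarnessLib

/-!
# The Route-G budget AT LEVEL `n` of the cyclotomic tower: classes over `ℚ_n` that are everywhere
# locally trivial over `ℚ_∞` INJECT into `Sel_{p^∞}(E/ℚ_∞)[p]` when `E(ℚ)[p] = 0`
# (cell `b2b-bsdres`, team n1011, seat p10 GEN 4; OWNERS row T-E3g-BUD0, FILE 1)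

HONEST FRAMING (cell `b2b-bsdres`, run/shared/lean/b2b/bsd-rank1-residual/, verbatim in every
file): the goal of the cell is to DELETE the COMBINATION-SHAPED residual classes of the
Birch–Swinnerton-Dyer formula for ALL analytic-rank `≤ 1` elliptic curves over `ℚ` — "full BSD
formula for every rank `≤ 1` curve in class `C`" assembled STRICTLY from published theorems — so
that the rank-`≤ 1` remainder becomes exactly the CONSTRUCTION-SHAPED classes, which are TYPED
(missing-input `Prop`s), NOT attempted. This is not "finishing BSD". Team n1011 (N10/N11: X4 ∧
`p = 3`): research routes on CONSTRUCTION-SHAPED classes; census output = EVIDENCE / conjecture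
items, never a Literature fact; RESIDUAL-MAP marks UNCHANGED; nothing is booked by this file.
THEOREMS ONLY: no definition, no named fact, nothing asserted; X3♯ / X4♯ stay CONSTRUCTION-shaped.

## What and why (ROUTE-2 II.13.2 / II.14.2 / II.15.2; LIT-INPUTS-P3 §29)

Route G's typed `p`-Tamagawa budget `BudgetLeLambdaAt p W b` ("`μ(X) = 0 ⟹ b ≤ λ(X(E/ℚ_∞))`",
`CongruentPartnerMainConjecture.lean`) factors — cc-typer-2's schema
`CongruentPartnerBudgetSchema.lean`, seat p12's `CongruentPartnerBudgetSchemaHolds.lean` — through the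
Greenberg-1999 Prop. 4.14 record (no finite `Λ`-submodule when `p ∤ #E(ℚ)_tors`) and the ONE residual
count `ResidualSelmerRankGeAt p W b` (`p ^ b ≤ #Sel_{p^∞}(E/ℚ_∞)[p]`), for which NO printed
discharge exists on reducible rows (n1011-lit, LIT-INPUTS-P3 §29.3: EPW 2006 Cor. 3.2.5 is
irreducible-only via level lowering; Greenberg 2010 Prop. 3.2.1 would need instantiating).

THIS FILE moves that Iwasawa-level count DOWN THE TOWER, image-free, from one tree input only —
`E(ℚ)[p] = 0` (equivalently `p ∤ #E(ℚ)_tors`, §1). Then `E(ℚ_∞)[p^∞] = 0` (Greenberg LNM 1716 §1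
p. 62, the tree's `fixedPoints_kerSubgroup_geomPrimaryTorsion_eq_bot`), so every restriction
`h_n : H¹(ℚ_n, E[p^∞]) → H¹(ℚ_∞, E[p^∞])` is INJECTIVE (§2: `#ker h_n = #E(ℚ_n)[p^∞] = 1`, the
tree's `natCard_ker_layerToInfty_eq_natCard_fixedPoints`), and it carries the tree's
`A_n = h_n⁻¹(Sel_∞)` (`selmerInftyPreimage κ n`: classes over `ℚ_n` everywhere locally trivial over
`ℚ_∞` — Greenberg's `ker g_n = A_n / Sel_n`, LNM 1716 §3 p. 85) into `Sel_∞`. Hence (§3)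
`#A_n[p] ≤ #Sel_∞[p]`, and (§4) for every `n`:

  `(∀ κ cyclotomic, A_n[p] contains ≥ p ^ b classes) ⟹ BudgetLeLambdaAt p W b`

(the input as a finite SET of classes, so that no finiteness of `A_n[p]` — a local question at `p`
— is ever needed) on rows with `p ∤ #E(ℚ)_tors` (Prop. 4.14 record BY NAME + p12's `λ` READ OFF `Sel_∞[p]`). At
`n = 0` the input is a `p`-DESCENT statement over `ℚ`: `A_0[p] ⊇` the image of the `p`-Selmer group
of `E[p]` for the Kummer structure RELAXED to "Kummer + unramified" at the Tamagawa primes `ℓ ≠ p`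
(an unramified class dies on `G_{ℚ_{∞,η}} ⊋ I_ℓ` since `G_{ℚ_{∞,η}}/I_ℓ` is pro-prime-to-`p`), whose
order Poitou–Tate COUNTING over `ℚ` bounds below by `p^{#T}`, `T` the set of Tamagawa primes with
`H¹_ur(ℚ_ℓ, E[p]) ⊄ im κ_ℓ` — the sequel files of row T-E3g-BUD0. §5 plugs the level-`n` input into
the X4♯(G-ord) rank-`0` ends of `CongruentPartnerMainConjectureGordBSD.lean` (there `p ∤ #E(ℚ)_tors`
is a THEOREM from `Surj W p`).

HONEST LIMIT (said up front): at level `0` the count reaches the number of DISTINCT Tamagawa primes,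
which is the census budget `B(E,p) = Σ_ℓ s_ℓ·[p ∣ c_ℓ]` iff every Tamagawa prime has `s_ℓ = 1`
(`ℓ^{p−1} ≢ 1 (mod p²)`; at `p = 3`: `ℓ ≢ ±1 (mod 9)`); the `s_ℓ > 1` surplus needs the level
`n ≥ v_p(s_ℓ)` statement, which this file ALSO provides (same theorem, any `n`).

No level lowering, no Λ-adic or residual global-to-local surjectivity over `ℚ_∞`, no Kato input:
only the control-theorem kernel count of the tree.

References: R. Greenberg, LNM 1716 (1999) §1 p. 62, §3 pp. 85–86, §4 Lemma 4.3 p. 103, Prop. 4.14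
p. 114 [GreenbergLNM1716]; Y. Hachimori, K. Matsuno, Proc. AMS 128 (2000) Cor. (i)
[HachimoriMatsuno2000]; M. Emerton, R. Pollack, T. Weston, Invent. Math. 163 (2006) §3.2
[EmertonPollackWeston2006]; ROUTE-2 II.13.2, II.14.2, II.15.2 (cells/n1011/); LIT-INPUTS-P3 §29.
-/

set_option autoImplicit false

noncomputable section

open scoped Classical

open WeierstrassCurve Literature.NumberTheory.EllipticCurves
  Literature.NumberTheory.EllipticCurves.ModularForms
  Literature.NumberTheory.EllipticCurves.Rank1Residual
  Literature.NumberTheory.EllipticCurves.Rank1Residual.Typed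
  Literature.NumberTheory.EllipticCurves.Wuthrich2014
  Literature.NumberTheory.EllipticCurves.Delbourgo2002
  Summit.BirchSwinnertonDyer.Rank1Residual.Iwasawa

namespace Summit.BirchSwinnertonDyer.Rank1Residual.Additive

universe u

/-! ### §1 `p ∤ #E(K)_tors ⟹ E(K)[p] = 0` -/

section NoPTorsion

variable {K : Type u} [Field K] [NumberField K] (W : WeierstrassCurve K) [W.IsElliptic]
  (p : ℕ) [hp : Fact p.Prime]

omit [NumberField K] [W.IsElliptic] in
/-- **`p ∤ #E(K)_tors ⟹ E(K)` has no point of order `p`**: a non-zero `P` with `p • P = 0` is a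
torsion point of order exactly `p`, and the order of an element divides the (finite, Silverman AEC
Cor. VIII.6.7.1, tree `finite_torsion_point`) order of `E(K)_tors`. The hypothesis shape
`∀ P, p • P = 0 → P = 0` is the one consumed by the tree's tower-torsion theorems
(`fixedPoints_kerSubgroup_geomPrimaryTorsion_eq_bot`). [folklore] -/
theorem forall_smul_eq_zero_of_not_dvd_torsionOrder (htors : ¬ p ∣ W.torsionOrder)
    (P : W.toAffine.Point) (hP : p • P = 0) : P = 0 := by
  by_contra hne
  apply htors
  have hfin : IsOfFinAddOrder P := isOfFinAddOrder_iff_nsmul_eq_zero.mpr ⟨p, hp.out.pos, hP⟩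
  have hord : addOrderOf P = p := by
    have h1 : addOrderOf P ∣ p := addOrderOf_dvd_of_nsmul_eq_zero hP
    rcases (Nat.dvd_prime hp.out).mp h1 with h | h
    · exact absurd (AddMonoid.addOrderOf_eq_one_iff.mp h) hne
    · exact h
  have hmem : P ∈ AddCommGroup.torsion W.toAffine.Point := hfin
  have hT : addOrderOf (⟨P, hmem⟩ : AddCommGroup.torsion W.toAffine.Point) = p := by
    rw [← hord]
    exact AddSubgroup.addOrderOf_mk P hmem
  unfold WeierstrassCurve.torsionOrder
  rw [← hT]
  exact addOrderOf_dvd_natCard _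

/-- `Surj W p ⟹ p ∤ #E(ℚ)_tors` (surjective ⟹ irreducible ⟹ no rational `p`-torsion).
[cite: Mazur1977, Ch. III §5, p. 157] -/
theorem not_dvd_torsionOrder_of_surj (V : WeierstrassCurve ℚ) [V.IsElliptic] (hsurj : Surj V p) :
    ¬ p ∣ V.torsionOrder := by
  haveI : NeZero (p : ℚ) := ⟨by exact_mod_cast hp.out.ne_zero⟩
  exact fun h ↦ not_hasIrreducibleModPGaloisRep_of_dvd_torsionOrder V p h
    (hasIrreducibleModPGaloisRep_of_hasSurjectiveModNGaloisRep V p hsurj)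

/-- `Irr W p ⟹ p ∤ #E(ℚ)_tors` (a rational point of order `p` spans a `Γ_ℚ`-stable line; Mazur 1977
Ch. III §5 p. 157; tree `not_hasIrreducibleModPGaloisRep_of_dvd_torsionOrder`) — the X3♯-free /
image-light form: reducible rows carry `p ∤ #E(ℚ)_tors` as a census bit instead.
[cite: Mazur1977, Ch. III §5, p. 157] -/
theorem not_dvd_torsionOrder_of_irr' (V : WeierstrassCurve ℚ) [V.IsElliptic] (hirr : Irr V p) :
    ¬ p ∣ V.torsionOrder :=
  fun h ↦ not_hasIrreducibleModPGaloisRep_of_dvd_torsionOrder V p h hirr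

end NoPTorsion

/-! ### §2 `E(K)[p] = 0 ⟹` every restriction `h_n : H¹(K_n, E[p^∞]) → H¹(K_∞, E[p^∞])` is injective -/

section Injective

variable {K : Type u} [Field K] [NumberField K] (W : WeierstrassCurve K) [W.IsElliptic]
  {p : ℕ} [hp : Fact p.Prime] (κ : ZpExtension K p)

/-- **`ker h_n = 0` when `E(K)[p] = 0`**, for ANY `ℤ_p`-extension `K_∞/K` of a number field and
every layer `n`: `#ker h_n = #E[p^∞]^{Gal(K̄/K_n)}` (Greenberg LNM 1716 proof of Lemma 4.3, tree
`natCard_ker_layerToInfty_eq_natCard_fixedPoints`, its finiteness hypothesis `E(K_∞)[p^∞]` finite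
supplied by `fixedPoints_kerSubgroup_geomPrimaryTorsion_eq_bot`) `= 1`
(`natCard_fixedBy_layerSubgroup_eq_one`). [cite: GreenbergLNM1716, §3 Lemma 3.1 and §4 Lemma 4.3 (p. 103)] -/
theorem ker_layerToInfty_eq_bot_of_no_pTorsion (hK : ∀ P : W.toAffine.Point, p • P = 0 → P = 0)
    (n : ℕ) : (W.layerToInfty κ n).ker = ⊥ := by
  haveI := W.finite_fixedPoints_kerSubgroup_geomPrimaryTorsion κ hK
  have h := W.natCard_ker_layerToInfty_eq_natCard_fixedPoints κ n
  rw [W.natCard_fixedBy_layerSubgroup_eq_one κ hK n] at h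
  exact AddSubgroup.eq_bot_of_card_eq _ h

/-- **`h_n : H¹(K_n, E[p^∞]) → H¹(K_∞, E[p^∞])` is injective when `E(K)[p] = 0`** (inflation–
restriction: `ker h_n = H¹(Γ_n, E(K_∞)[p^∞]) = 0`). [cite: GreenbergLNM1716, §3 Lemma 3.1 (p. 86)] -/
theorem layerToInfty_injective_of_no_pTorsion (hK : ∀ P : W.toAffine.Point, p • P = 0 → P = 0)
    (n : ℕ) : Function.Injective (W.layerToInfty κ n) :=
  (AddMonoidHom.ker_eq_bot_iff _).mp (ker_layerToInfty_eq_bot_of_no_pTorsion W κ hK n)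

/-! ### §3 `#A_n[p] ≤ #Sel_∞[p]`: the level-`n` classes inject into the `p`-torsion of `Sel_∞` -/

/-- The restriction `h_n` as a map on `p`-torsion: `A_n[p] → Sel_∞[p]`, `A_n = h_n⁻¹(Sel_∞)`
(`selmerInftyPreimage`; Greenberg's `ker g_n = A_n/Sel_n`, LNM 1716 §3 p. 85), INJECTIVE when
`E(K)[p] = 0`. [cite: GreenbergLNM1716, §3 pp. 85–86] -/
theorem exists_injective_torsion_selmerInftyPreimage_to_selmerInfty
    (hK : ∀ P : W.toAffine.Point, p • P = 0 → P = 0) (n : ℕ) :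
    ∃ f : {y : W.selmerInftyPreimage κ n // p • y = 0} → {s : W.selmerInfty κ // p • s = 0},
      Function.Injective f := by
  have hinj := layerToInfty_injective_of_no_pTorsion W κ hK n
  refine ⟨fun y ↦ ⟨⟨W.layerToInfty κ n (y.1 : W.subgroupH1 p (κ.layerSubgroup n)), y.1.2⟩, ?_⟩,
    ?_⟩
  · apply Subtype.ext
    have hy : ((p • y.1 : W.selmerInftyPreimage κ n) : W.subgroupH1 p (κ.layerSubgroup n)) = 0 := by
      rw [y.2]; rfl
    change p • W.layerToInfty κ n (y.1 : W.subgroupH1 p (κ.layerSubgroup n)) = 0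
    rw [← map_nsmul, ← AddSubgroup.coe_nsmul, hy, map_zero]
  · intro y₁ y₂ h
    have h' := congrArg (fun s : {s : W.selmerInfty κ // p • s = 0} ↦
      ((s.1 : W.selmerInfty κ) : W.subgroupH1 p κ.kerSubgroup)) h
    exact Subtype.ext (Subtype.ext (hinj h'))

/-- **`#A_n[p] ≤ #Sel_{p^∞}(E/K_∞)[p]` when `E(K)[p] = 0`** and the right side is finite
(`Nat.card`; on the rows of the budget node the finiteness is p12's
`finite_selmer_torsion_of_mu_zero_of_forall_finite_eq_bot`). [cite: GreenbergLNM1716, §3 pp. 85–86] -/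
theorem natCard_torsion_selmerInftyPreimage_le_of_no_pTorsion
    (hK : ∀ P : W.toAffine.Point, p • P = 0 → P = 0) (n : ℕ)
    (hfin : Finite {s : W.selmerInfty κ // p • s = 0}) :
    Nat.card {y : W.selmerInftyPreimage κ n // p • y = 0} ≤
      Nat.card {s : W.selmerInfty κ // p • s = 0} := by
  obtain ⟨f, hf⟩ := exists_injective_torsion_selmerInftyPreimage_to_selmerInfty W κ hK n
  exact Nat.card_le_card_of_injective f hf

/-- **Finite families of level-`n` classes are counted by `Sel_∞[p]`**: when `E(K)[p] = 0` and
`Sel_{p^∞}(E/K_∞)[p]` is finite, every finite set `s ⊆ A_n[p]` has `#s ≤ #Sel_∞[p]` (the form in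
which the level-`n` input is consumed: a finite set of classes, so that no finiteness of `A_n[p]`
itself — a local question at `p` — is ever needed). [cite: GreenbergLNM1716, §3 pp. 85–86] -/
theorem card_finset_torsion_selmerInftyPreimage_le_of_no_pTorsion
    (hK : ∀ P : W.toAffine.Point, p • P = 0 → P = 0) (n : ℕ)
    (hfin : Finite {s : W.selmerInfty κ // p • s = 0})
    (s : Finset {y : W.selmerInftyPreimage κ n // p • y = 0}) :
    s.card ≤ Nat.card {s : W.selmerInfty κ // p • s = 0} := by
  obtain ⟨f, hf⟩ := exists_injective_torsion_selmerInftyPreimage_to_selmerInfty W κ hK n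
  haveI : Fintype {s : W.selmerInfty κ // p • s = 0} := Fintype.ofFinite _
  rw [Nat.card_eq_fintype_card, ← Finset.card_map ⟨f, hf⟩]
  exact Finset.card_le_univ _

end Injective

/-! ### §4 The budget from the level-`n` count -/

section Budget

variable {W : WeierstrassCurve ℚ} [W.IsElliptic] [W.IsGloballyMinimal] {p : ℕ} [hp : Fact p.Prime]

/-- **The Route-G budget from LEVEL `n` of the tower (no-finite-submodule form).** If `p ∤ #E(ℚ)_tors`,
`X(E/ℚ_∞)` has no nonzero finite `Λ`-submodule for every cyclotomic datum ((b′), cc-typer-2's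
`NoFiniteSubmoduleAt p W`), and for every cyclotomic `κ` the level-`n` group
`A_n[p] = {y ∈ H¹(ℚ_n, E[p^∞])[p] : res y ∈ Sel_{p^∞}(E/ℚ_∞)}` contains a finite set of at least
`p ^ b` classes, then
`BudgetLeLambdaAt p W b`: for `D` torsion with `μ = 0`, `p ^ b ≤ #A_n[p] ≤ #Sel_∞[p] = p ^ λ(X)`
(§3 + p12's `pow_lambdaInvariant_eq_natCard_selmer_torsion`). [cite: GreenbergLNM1716, §3 pp. 85–86 and Prop. 4.14 (p. 114)] -/
theorem budgetLeLambdaAt_of_noFiniteSubmodule_of_layerClasses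
    (htors : ¬ p ∣ W.torsionOrder) (hnf : NoFiniteSubmoduleAt p W) (n : ℕ) {b : ℕ}
    (hA : ∀ (κ : ZpExtension ℚ p), κ.IsCyclotomic →
      ∃ s : Finset {y : W.selmerInftyPreimage κ n // p • y = 0}, p ^ b ≤ s.card) :
    BudgetLeLambdaAt p W b := by
  intro κ γ hκ hγ hT D _ hXt hμ
  have hK := forall_smul_eq_zero_of_not_dvd_torsionOrder W p htors
  have hnf' : ∀ N : Submodule (IwasawaAlgebra p) D.X, Finite N → N = ⊥ := hnf hκ hγ hT D hXt
  have hfin := finite_selmer_torsion_of_mu_zero_of_forall_finite_eq_bot p D hXt hμ hnf'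
  have hcard := pow_lambdaInvariant_eq_natCard_selmer_torsion p D hXt hμ hnf'
  obtain ⟨s, hs⟩ := hA κ hκ
  have h := hs.trans (card_finset_torsion_selmerInftyPreimage_le_of_no_pTorsion W κ hK n hfin s)
  rw [← hcard] at h
  exact (Nat.pow_le_pow_iff_right hp.out.one_lt).mp h

/-- **The Route-G budget from LEVEL `n` of the tower, on rows with `p ∤ #E(ℚ)_tors`** (the Prop. 4.14
record `Greenberg1999.prop414_noFiniteSubmodule_of_not_dvd_torsionOrder` BY NAME for (b′); `E(ℚ)[p] = 0`
from `p ∤ #E(ℚ)_tors`, §1): `(∀ κ cyclotomic, p ^ b ≤ #A_n[p]) ⟹ BudgetLeLambdaAt p W b`. At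
`n = 0`, `A_0[p]` = the classes of `H¹(ℚ, E[p^∞])[p]` everywhere locally trivial over `ℚ_∞` — a
`p`-descent count over `ℚ`. [cite: GreenbergLNM1716, Prop. 4.14 (p. 114) and §3 pp. 85–86]
[cite: HachimoriMatsuno2000, Corollary (i)] -/
theorem budgetLeLambdaAt_of_prop414_of_layerClasses
    (h414 : Greenberg1999.prop414_noFiniteSubmodule_of_not_dvd_torsionOrder)
    (htors : ¬ p ∣ W.torsionOrder) (n : ℕ) {b : ℕ}
    (hA : ∀ (κ : ZpExtension ℚ p), κ.IsCyclotomic →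
      ∃ s : Finset {y : W.selmerInftyPreimage κ n // p • y = 0}, p ^ b ≤ s.card) :
    BudgetLeLambdaAt p W b :=
  budgetLeLambdaAt_of_noFiniteSubmodule_of_layerClasses htors
    (noFiniteSubmoduleAt_of_prop414 h414 htors) n hA

/-- **The residual count itself from the level-`n` count** (cc-typer-2's `ResidualSelmerRankGeAt`),
on rows where `Sel_{p^∞}(E/ℚ_∞)[p]` is known finite for every cyclotomic `κ` (e.g. from `μ = 0` and
(b′) by p12's theorem): `p ∤ #E(ℚ)_tors ∧ (∀ κ, p ^ b ≤ #A_n[p]) ⟹ ResidualSelmerRankGeAt p W b`.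
[cite: GreenbergLNM1716, §3 pp. 85–86] -/
theorem residualSelmerRankGeAt_of_layerClasses (htors : ¬ p ∣ W.torsionOrder) (n : ℕ) {b : ℕ}
    (hfin : ∀ (κ : ZpExtension ℚ p), κ.IsCyclotomic → Finite {s : W.selmerInfty κ // p • s = 0})
    (hA : ∀ (κ : ZpExtension ℚ p), κ.IsCyclotomic →
      ∃ s : Finset {y : W.selmerInftyPreimage κ n // p • y = 0}, p ^ b ≤ s.card) :
    ResidualSelmerRankGeAt p W b := by
  intro κ hκ
  obtain ⟨s, hs⟩ := hA κ hκ
  exact hs.trans (card_finset_torsion_selmerInftyPreimage_le_of_no_pTorsion W κ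
    (forall_smul_eq_zero_of_not_dvd_torsionOrder W p htors) n (hfin κ hκ) s)

end Budget

/-! ### §5 X4♯(G-ord) rank-`0` ends of Route G over the level-`n` count (`p ∤ #E(ℚ)_tors` from `Surj`) -/

section Ends

variable {W : WeierstrassCurve ℚ} [W.IsElliptic] [W.IsGloballyMinimal] {p : ℕ} [hp : Fact p.Prime]

/-- **`BSD_p` at an X4♯(G-ord) ∩ `I₀*` RANK-`0` row, `p ≥ 5`, from Kato half + certificate + the
LEVEL-`n` count + non-anomalous** (= `ClassX4Gord.bsdp_rankZero_of_katoHalf_of_coeffCert_of_budget_of_nonAnomalous`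
with `hbud` supplied by §4). [cite: Kato2004Asterisque, Thm. 17.4 (3) (p. 273)] [cite: Delbourgo2002, Thm. (A), (B)]
[cite: GreenbergLNM1716, Prop. 4.14 (p. 114)] -/
theorem ClassX4Gord.bsdp_rankZero_of_katoHalf_of_coeffCert_of_layerClasses_of_nonAnomalous
    (hK : Wuthrich2014.kato_halfEigenCharIdeal_dvd_cyclotomicPrime_of_surjective)
    (hPal : Pal2012.thm32_sqrt_mul_realPeriodRat_twist_eq_of_prime_one_mod_four)
    (hDel98 : Delbourgo1998.prop4_rankZero_pow_dvd_constantCoeff) (hDel : Delbourgo2002.mainTheorem)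
    (hGZK : rank_eq_analyticRank_of_analyticRank_le_one) (hmod : hasEntireLFunction_rat)
    (hmodD : nonempty_modularParametrizationData)
    (h414 : Greenberg1999.prop414_noFiniteSubmodule_of_not_dvd_torsionOrder)
    (hX : ClassX4Gord W p) (hcm : ¬ W.HasCM) (hp5 : 5 ≤ p) (he : semistabilityIndex W p = 2)
    (hsurj : Surj W p) (hr : W.analyticRank = 0)
    {b : ℕ} (hcert : BranchUnitCoeffAt W p b) (n : ℕ)
    (hA : ∀ (κ : ZpExtension ℚ p), κ.IsCyclotomic →
      ∃ s : Finset {y : W.selmerInftyPreimage κ n // p • y = 0}, p ^ b ≤ s.card)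
    (hna : ReductionNonAnomalous W p) : BSDp W p :=
  hX.bsdp_rankZero_of_katoHalf_of_coeffCert_of_budget_of_nonAnomalous hK hPal hDel98 hDel hGZK hmod
    hmodD hcm hp5 he hsurj hr hcert
    (budgetLeLambdaAt_of_prop414_of_layerClasses h414 (not_dvd_torsionOrder_of_surj p W hsurj) n hA)
    hna

/-- **`BSD_3` at an X4♯(G-ord) ∩ `I₀*` RANK-`0` row AT `p = 3`, from Kato half + certificate + the
LEVEL-`n` count + non-anomalous** (= the Pal-free `…_of_budget_of_nonAnomalous_noPal` end with `hbud`
supplied by §4; the N10/N11 LOWER rows of the cell). [cite: Kato2004Asterisque, Thm. 17.4 (3) (p. 273)]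
[cite: Delbourgo2002, Thm. (A), (B) at p = 3] [cite: GreenbergLNM1716, Prop. 4.14 (p. 114)] -/
theorem ClassX4Gord.bsdp_three_rankZero_of_katoHalf_of_coeffCert_of_layerClasses_of_nonAnomalous
    {W : WeierstrassCurve ℚ} [W.IsElliptic] [W.IsGloballyMinimal] [Fact (3 : ℕ).Prime]
    (hK : Wuthrich2014.kato_halfEigenCharIdeal_dvd_cyclotomicPrime_of_surjective)
    (hDel98 : Delbourgo1998.prop4_rankZero_pow_dvd_constantCoeff)
    (hDel3 : Delbourgo2002.mainTheorem_three)
    (hGZK : rank_eq_analyticRank_of_analyticRank_le_one) (hmod : hasEntireLFunction_rat)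
    (hmodD : nonempty_modularParametrizationData)
    (h414 : Greenberg1999.prop414_noFiniteSubmodule_of_not_dvd_torsionOrder)
    (hX : ClassX4Gord W 3) (hcm : ¬ W.HasCM) (hsurj : Surj W 3) (hr : W.analyticRank = 0)
    {b : ℕ} (hcert : BranchUnitCoeffAt W 3 b) (n : ℕ)
    (hA : ∀ (κ : ZpExtension ℚ 3), κ.IsCyclotomic →
      ∃ s : Finset {y : W.selmerInftyPreimage κ n // 3 • y = 0}, 3 ^ b ≤ s.card)
    (hna : ReductionNonAnomalous W 3) : BSDp W 3 :=
  hX.bsdp_three_rankZero_of_katoHalf_of_coeffCert_of_budget_of_nonAnomalous_noPal hK hDel98 hDel3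
    hGZK hmod hmodD hcm hsurj hr hcert
    (budgetLeLambdaAt_of_prop414_of_layerClasses h414 (not_dvd_torsionOrder_of_surj 3 W hsurj) n hA)
    hna

end Ends

end Summit.BirchSwinnertonDyer.Rank1Residual.Additive

end
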